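import Literature.NumberTheory.EllipticCurves.Zywina2025RankTwo
import Literature.NumberTheory.EllipticCurves.PAdicRegulatorFiniteIndexProofs
import Literature.NumberTheory.EllipticCurves.CanonicalPAdicHeightNumeratorProofs
import Literature.NumberTheory.EllipticCurves.CanonicalPAdicHeightAdmissibilityCriteria
import HarnessLib

/-!
# Zywina's rank-2 family `E_{m,n}`: the points `P₁, P₂, P₁ + P₂` and their doubles (file 1 of 4 of
# the kernel form of cell bsd-rank2's THEOREM R* — closed-form canonical `p`-adic heights and
# Schneider's conjecture for `E_{m,n}` at primes `p ≥ 5`, `p ∣ n`, `‖n‖_p² < ‖½ log_p m‖_p)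

Cell-side file (the cell's OWN result, not a published statement — hence not under `Literature/`).
`E_{m,n} : y² = x³ - 5q x² + 4qr x` (`q = m + 16n²`, `r = m + 25n²`) is Zywina's rank-`2` family
(`Literature.NumberTheory.EllipticCurves.Zywina2025RankTwo`: `zywinaCurve`, `ZywinaAdmissible`,
`mordellWeilRank_zywinaCurve`), with Zywina's points `P₁ = (q, 6nq)`, `P₂ = (36n², 12n(m - 2n²))`.

**THEOREM R\* (HOME/p2/PADIC-R2-G3.md §1–§2, refereed PASS in REFEREE-R2.md report #8).** For
`(m, n)` admissible, `p ≥ 5` prime with `p ∣ n`, and `D` THE canonical `p`-adic height datum of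
`E_{m,n}` (`PAdicHeightData.IsCanonical`, Stein–Wuthrich normalisation), with `Λ = ½ log_p m`:

  (i)  `‖⟨P₁,P₁⟩ - Λ‖_p ≤ ‖n‖_p²`, `‖⟨P₂,P₂⟩ - 2Λ‖_p ≤ ‖n‖_p²`, `‖⟨P₁+P₂,P₁+P₂⟩ - Λ‖_p ≤ ‖n‖_p²`
       (`closedFormHeights`; `‖n‖_p² = p^{-2ν}`, the STRONG form of the memo);
  (ii) if `‖n‖_p² < ‖Λ‖_p` then `Reg_D(P₁, P₂) ≠ 0` (`padicRegulatorOf_ne_zero`);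
  (iii) hence `SchneiderConjecture D` (`schneiderConjecture`), by the index lemma on the rank-`2`
       curve `E_{m,n}`.

Proof = memo §2, formalised over the Literature ingredients landed for it:
* LEMMA H (`CanonicalPAdicHeightNumeratorProofs.lean`, p404730):
  `‖ĥ_p(Q) - log_p(num x(Q))‖_p ≤ ‖x(Q)‖_p⁻¹` for `a₁ = a₃ = 0`;
* admissibility toolkit (`CanonicalPAdicHeightAdmissibilityCriteria.lean`, p405432): coordinate
  tests for `E₀`, good primes via the resultant, torsion-freeness of `E₁(ℚ_p)` for integral
  equations, `isAdmissible_of_one_lt_norm`, the duplication `x`-coordinate;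
* index formula (`PAdicRegulatorFiniteIndexProofs.lean`, p404469):
  `schneiderConjecture_of_padicRegulatorOf_pair_ne_zero`.
Here: §Setup (integrality, `a₁ = a₃ = a₆ = 0`, arithmetic of admissible `(m,n)`: `2, 3 ∣ n`,
`m, q, r ∤ n`); §Points (`P₁ + P₂ = (4q, 12nq)`, `x(2P₁) = (m+28n²)²/(4n)²`,
`x(2P₂) = (m²+41mn²+76n⁴)²/(6n(m-2n²))²`, `x(2(P₁+P₂)) = (m+13n²)²/(2n)²`); §Coprime (numerators
and denominators are coprime); §Reduction (`2P₁`, `2P₂` reduce non-singularly at EVERY prime: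
denominator primes by `‖x‖_ℓ > 1`, the bad primes `m, q, r` by the unit test `‖y‖_ℓ = 1` computed
modulo `ℓ` — `(y d³)² = N ≡ c·n^k` with `c ∈ {2¹²3⁴7², 2¹²3⁶, 3¹⁰, 2¹²19², 2¹²3²⁴, 2¹⁰3²⁴7²}` —
and all other primes by `ℓ ∤ Δ = 2⁸3²mq³r²`; `2(P₁+P₂) = 2P₁ + 2P₂` by the subgroup property of
`E₀`); §Admissible (at `p ∣ n`: `‖x(2P_i)‖_p⁻¹ = ‖n‖_p²`); §Heights (`⟨P,P⟩ = ¼ĥ_p(2P)`,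
`log_p(num) = 2 log_p α`, `α = m(1 + O(n²))` resp. `m²(1 + O(n²))`); §ClosedForm ((i)–(iii); the
`2 × 2` ultrametric perturbation is p2-g3's `PadicRank2SketchG3` §A).

B1 honesty: `p`-adic height ALGEBRA on a rank-`2` family; no clause mentions the analytic rank; this
is node N3 of `HOME/S0-DOORS.md` (the regulator door, INSIDE the Schneider barrier) made kernel at
member level — the class level (`C(p,K,m₁,M)`, Tao–Ziegler) is p2's `PadicRank2SketchG3` §E, whose
hypothesis `ClosedFormHeights p m n (p^{-ν})` follows from `closedFormHeights` here
(`‖n‖_p² ≤ ‖n‖_p ≤ p^{-ν}`) and whose `schneider_of_padicRegulatorOf_ne_zero` is the tree theorem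
`schneiderConjecture_of_padicRegulatorOf_pair_ne_zero`.

Files: `ZywinaFamilyPoints` (this one: §Setup, §Points, §Doubles, §Generic) →
`ZywinaFamilyReduction` (§Coprime, §Reduction: `2P₁`, `2P₂` reduce non-singularly at every prime) →
`ZywinaFamilyAdmissible` (§Admissible: admissibility at `p ∣ n`, `‖x(2P_i)‖_p⁻¹ = ‖n‖_p²`) →
`ZywinaFamilyPAdicHeights` (§Heights, §ClosedForm: THEOREM R* (i)–(iii)).
No definitions, no notations, no named facts: theorems only (the points are the terms
`Affine.Point.some _ _ (nonsingular_P₁ h)` etc.).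
-/

noncomputable section

open scoped Classical
open Literature.NumberTheory.EllipticCurves Literature.NumberTheory.EllipticCurves.Zywina2025
open WeierstrassCurve

namespace Summit.BirchSwinnertonDyer.Rank2Observatory.ZywinaFamily

/-! ### The curve: normal form, integrality, basic arithmetic of admissible parameters -/

section Setup

variable (m n : ℕ)

/-- `E_{m,n}` has `a₁ = a₃ = 0`. -/
theorem isCharNeTwoNF_zywinaCurve : (zywinaCurve m n).IsCharNeTwoNF := ⟨rfl, rfl⟩

/-- `E_{m,n}` has integer coefficients. -/
theorem isIntegral_zywinaCurve : (zywinaCurve m n).IsIntegral ℤ := by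
  refine WeierstrassCurve.isIntegral_of_exists_lift ℤ ⟨0, by simp [zywinaCurve]⟩
    ⟨-5 * ((m : ℤ) + 16 * (n : ℤ) ^ 2), ?_⟩ ⟨0, by simp [zywinaCurve]⟩
    ⟨4 * ((m : ℤ) + 16 * (n : ℤ) ^ 2) * ((m : ℤ) + 25 * (n : ℤ) ^ 2), ?_⟩ ⟨0, by simp [zywinaCurve]⟩ <;>
  · simp [zywinaCurve]

/-- `a₆ = 0`. -/
theorem zywinaCurve_a₆ : (zywinaCurve m n).a₆ = 0 := rfl
/-- `a₂ = -5q`. -/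
theorem zywinaCurve_a₂ : (zywinaCurve m n).a₂ = -5 * ((m : ℚ) + 16 * (n : ℚ) ^ 2) := rfl
/-- `a₄ = 4qr`. -/
theorem zywinaCurve_a₄ :
    (zywinaCurve m n).a₄ = 4 * ((m : ℚ) + 16 * (n : ℚ) ^ 2) * ((m : ℚ) + 25 * (n : ℚ) ^ 2) := rfl

variable {m n}

/-- `0 < n`. -/
theorem adm_n_pos (h : ZywinaAdmissible m n) : 0 < n := h.1
/-- `m` is prime. -/
theorem adm_m_prime (h : ZywinaAdmissible m n) : m.Prime := h.2.1
/-- `q = m + 16n²` is prime. -/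
theorem adm_q_prime (h : ZywinaAdmissible m n) : (m + 16 * n ^ 2).Prime := h.2.2.1
/-- `r = m + 25n²` is prime. -/
theorem adm_r_prime (h : ZywinaAdmissible m n) : (m + 25 * n ^ 2).Prime := h.2.2.2.1
/-- `m ≡ 11 (mod 24)`. -/
theorem adm_m_mod (h : ZywinaAdmissible m n) : m % 24 = 11 := h.2.2.2.2.1
/-- `q ≡ 11 (mod 24)`. -/
theorem adm_q_mod (h : ZywinaAdmissible m n) : (m + 16 * n ^ 2) % 24 = 11 := h.2.2.2.2.2.1
/-- `r ≡ 11 (mod 24)`. -/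
theorem adm_r_mod (h : ZywinaAdmissible m n) : (m + 25 * n ^ 2) % 24 = 11 := h.2.2.2.2.2.2

/-- `3 ∣ n` (from `m ≡ q ≡ 11 (mod 24)`). -/
theorem adm_three_dvd_n (h : ZywinaAdmissible m n) : 3 ∣ n := by
  have hm24 := adm_m_mod h; have hq24 := adm_q_mod h
  have h48 : 3 ∣ 16 * n ^ 2 := by omega
  rcases (Nat.Prime.dvd_mul Nat.prime_three).mp h48 with h3 | h3
  · omega
  · exact Nat.prime_three.dvd_of_dvd_pow h3

/-- `2 ∣ n` (from `m ≡ r ≡ 11 (mod 24)`). -/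
theorem adm_two_dvd_n (h : ZywinaAdmissible m n) : 2 ∣ n := by
  have hm24 := adm_m_mod h; have hr24 := adm_r_mod h
  have h8 : 2 ∣ 25 * n ^ 2 := by omega
  rcases (Nat.Prime.dvd_mul Nat.prime_two).mp h8 with h2 | h2
  · omega
  · exact Nat.prime_two.dvd_of_dvd_pow h2

/-- `m ∤ n` (else `m ∣ q`, `m = q`). -/
theorem adm_not_m_dvd_n (h : ZywinaAdmissible m n) : ¬ m ∣ n := by
  intro hmn
  have hmq : m ∣ m + 16 * n ^ 2 := dvd_add dvd_rfl (dvd_mul_of_dvd_right (dvd_pow hmn two_ne_zero) _)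
  have := (Nat.prime_dvd_prime_iff_eq (adm_m_prime h) (adm_q_prime h)).mp hmq
  have := adm_n_pos h
  nlinarith

/-- `q ∤ n` (`0 < n < q`). -/
theorem adm_not_q_dvd_n (h : ZywinaAdmissible m n) : ¬ (m + 16 * n ^ 2) ∣ n := by
  intro hd
  have := Nat.le_of_dvd (adm_n_pos h) hd
  have := adm_n_pos h
  nlinarith

/-- `r ∤ n` (`0 < n < r`). -/
theorem adm_not_r_dvd_n (h : ZywinaAdmissible m n) : ¬ (m + 25 * n ^ 2) ∣ n := by
  intro hd
  have := Nat.le_of_dvd (adm_n_pos h) hd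
  have := adm_n_pos h
  nlinarith

/-- A prime `≡ 11 (mod 24)` is coprime to `2, 3, 7, 13, 19`. -/
theorem coprime_small_of_mod {ℓ : ℕ} (hℓ : ℓ.Prime) (h24 : ℓ % 24 = 11) :
    ℓ.Coprime 2 ∧ ℓ.Coprime 3 ∧ ℓ.Coprime 7 ∧ ℓ.Coprime 13 ∧ ℓ.Coprime 19 := by
  refine ⟨(Nat.coprime_primes hℓ Nat.prime_two).mpr (by omega),
    (Nat.coprime_primes hℓ Nat.prime_three).mpr (by omega),
    (Nat.coprime_primes hℓ (by norm_num)).mpr (by omega),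
    (Nat.coprime_primes hℓ (by norm_num)).mpr (by omega),
    (Nat.coprime_primes hℓ (by norm_num)).mpr (by omega)⟩

end Setup

/-! ### Zywina's points `P₁ = (q, 6nq)`, `P₂ = (36n², 12n(m-2n²))`, their sum and their doubles -/

section Points

variable {m n : ℕ}

/-- Transport of the `x`-coordinate in a point identity. -/
private theorem exists_some_of_eq {V : WeierstrassCurve ℚ} {P : V.toAffine.Point} {x₁ x₂ : ℚ}
    (h : ∃ (y : ℚ) (h₁ : V.toAffine.Nonsingular x₁ y), P = .some x₁ y h₁) (hx : x₁ = x₂) :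
    ∃ (y : ℚ) (h₂ : V.toAffine.Nonsingular x₂ y), P = .some x₂ y h₂ := by
  subst hx; exact h

/-- `P₁ = (q, 6nq)` lies on `E_{m,n}`. -/
theorem nonsingular_P₁ (h : ZywinaAdmissible m n) :
    (zywinaCurve m n).toAffine.Nonsingular ((m : ℚ) + 16 * (n : ℚ) ^ 2)
      (6 * n * ((m : ℚ) + 16 * (n : ℚ) ^ 2)) := by
  haveI := isElliptic_zywinaCurve h
  refine (WeierstrassCurve.Affine.equation_iff_nonsingular).mp ?_
  rw [WeierstrassCurve.Affine.equation_iff]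
  simp only [zywinaCurve]
  ring

/-- `P₂ = (36n², 12n(m - 2n²))` lies on `E_{m,n}`. -/
theorem nonsingular_P₂ (h : ZywinaAdmissible m n) :
    (zywinaCurve m n).toAffine.Nonsingular (36 * (n : ℚ) ^ 2)
      (12 * n * ((m : ℚ) - 2 * (n : ℚ) ^ 2)) := by
  haveI := isElliptic_zywinaCurve h
  refine (WeierstrassCurve.Affine.equation_iff_nonsingular).mp ?_
  rw [WeierstrassCurve.Affine.equation_iff]
  simp only [zywinaCurve]
  ring

/-- `P₃ = (4q, 12nq)` lies on `E_{m,n}`. -/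
theorem nonsingular_P₃ (h : ZywinaAdmissible m n) :
    (zywinaCurve m n).toAffine.Nonsingular (4 * ((m : ℚ) + 16 * (n : ℚ) ^ 2))
      (12 * n * ((m : ℚ) + 16 * (n : ℚ) ^ 2)) := by
  haveI := isElliptic_zywinaCurve h
  refine (WeierstrassCurve.Affine.equation_iff_nonsingular).mp ?_
  rw [WeierstrassCurve.Affine.equation_iff]
  simp only [zywinaCurve]
  ring

end Points

section Doubles

variable {m n : ℕ}

/-- Basic non-vanishing: `n ≠ 0`, `q ≠ 0`, `m - 2n² ≠ 0` in `ℚ`. -/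
private theorem ne_zero_aux (h : ZywinaAdmissible m n) :
    (n : ℚ) ≠ 0 ∧ ((m : ℚ) + 16 * (n : ℚ) ^ 2) ≠ 0 ∧ ((m : ℚ) - 2 * (n : ℚ) ^ 2) ≠ 0 := by
  have hn' : (0 : ℚ) < n := by exact_mod_cast (adm_n_pos h)
  refine ⟨hn'.ne', by positivity, ?_⟩
  intro h0
  have h1 : (m : ℤ) = 2 * (n : ℤ) ^ 2 := by exact_mod_cast (sub_eq_zero.mp h0)
  obtain ⟨k, hk⟩ : ∃ k : ℤ, (n : ℤ) ^ 2 = k := ⟨_, rfl⟩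
  rw [hk] at h1
  have := (adm_m_mod h)
  omega

/-- **`P₁ + P₂ = P₃ = (4q, 12nq)`** (chord of slope `-6n`). -/
theorem P₁_add_P₂ (h : ZywinaAdmissible m n) :
    (Affine.Point.some _ _ (nonsingular_P₁ h)) + (Affine.Point.some _ _ (nonsingular_P₂ h)) =
      .some _ _ (nonsingular_P₃ h) := by
  obtain ⟨hn, hq, hm2⟩ := ne_zero_aux h
  have hx : ((m : ℚ) + 16 * (n : ℚ) ^ 2) ≠ 36 * (n : ℚ) ^ 2 := by
    intro e
    have h1 : (m : ℤ) + 16 * (n : ℤ) ^ 2 = 36 * (n : ℤ) ^ 2 := by exact_mod_cast e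
    obtain ⟨k, hk⟩ : ∃ k : ℤ, (n : ℤ) ^ 2 = k := ⟨_, rfl⟩
    rw [hk] at h1
    have := (adm_m_mod h); omega
  rw [WeierstrassCurve.Affine.Point.add_of_X_ne hx]
  have hslope : (zywinaCurve m n).toAffine.slope ((m : ℚ) + 16 * (n : ℚ) ^ 2) (36 * (n : ℚ) ^ 2)
      (6 * n * ((m : ℚ) + 16 * (n : ℚ) ^ 2)) (12 * n * ((m : ℚ) - 2 * (n : ℚ) ^ 2)) = -6 * n := by
    rw [WeierstrassCurve.Affine.slope_of_X_ne hx, div_eq_iff (sub_ne_zero.mpr hx)]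
    ring
  congr 1
  · rw [WeierstrassCurve.Affine.addX, hslope]; simp only [zywinaCurve]; ring
  · rw [WeierstrassCurve.Affine.addY, WeierstrassCurve.Affine.negAddY, WeierstrassCurve.Affine.addX,
      hslope, WeierstrassCurve.Affine.negY]
    simp only [zywinaCurve]; ring

/-- **`2P₁ = ((m+28n²)²/(4n)², ·)`.** -/
theorem two_nsmul_P₁ (h : ZywinaAdmissible m n) :
    ∃ (y : ℚ) (h' : (zywinaCurve m n).toAffine.Nonsingular
      ((((m + 28 * n ^ 2 : ℕ) : ℚ) ^ 2) / (((4 * n : ℕ) : ℚ) ^ 2)) y),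
      2 • (Affine.Point.some _ _ (nonsingular_P₁ h)) = .some _ y h' := by
  haveI := isCharNeTwoNF_zywinaCurve m n
  haveI := isIntegral_zywinaCurve m n
  obtain ⟨hn, hq, hm2⟩ := ne_zero_aux h
  have hy : 2 * (6 * n * ((m : ℚ) + 16 * (n : ℚ) ^ 2)) ≠ 0 := by positivity
  refine exists_some_of_eq ((zywinaCurve m n).exists_two_nsmul_eq rfl (nonsingular_P₁ h) hy) ?_
  simp only [zywinaCurve]; push_cast
  field_simp
  ring

/-- **`2P₂ = ((m²+41mn²+76n⁴)²/(6n(m-2n²))², ·)`.** -/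
theorem two_nsmul_P₂ (h : ZywinaAdmissible m n) :
    ∃ (y : ℚ) (h' : (zywinaCurve m n).toAffine.Nonsingular
      ((((m ^ 2 + 41 * m * n ^ 2 + 76 * n ^ 4 : ℕ) : ℚ) ^ 2) /
        ((6 * (n : ℚ) * ((m : ℚ) - 2 * (n : ℚ) ^ 2)) ^ 2)) y),
      2 • (Affine.Point.some _ _ (nonsingular_P₂ h)) = .some _ y h' := by
  haveI := isCharNeTwoNF_zywinaCurve m n
  haveI := isIntegral_zywinaCurve m n
  obtain ⟨hn, hq, hm2⟩ := ne_zero_aux h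
  have hy : 2 * (12 * n * ((m : ℚ) - 2 * (n : ℚ) ^ 2)) ≠ 0 := by
    refine mul_ne_zero two_ne_zero (mul_ne_zero (mul_ne_zero (by norm_num) hn) hm2)
  refine exists_some_of_eq ((zywinaCurve m n).exists_two_nsmul_eq rfl (nonsingular_P₂ h) hy) ?_
  simp only [zywinaCurve]; push_cast
  field_simp
  ring

/-- **`2(P₁ + P₂) = ((m+13n²)²/(2n)², ·)`.** -/
theorem two_nsmul_P₁_add_P₂ (h : ZywinaAdmissible m n) :
    ∃ (y : ℚ) (h' : (zywinaCurve m n).toAffine.Nonsingular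
      ((((m + 13 * n ^ 2 : ℕ) : ℚ) ^ 2) / (((2 * n : ℕ) : ℚ) ^ 2)) y),
      2 • ((Affine.Point.some _ _ (nonsingular_P₁ h)) +
        (Affine.Point.some _ _ (nonsingular_P₂ h))) = .some _ y h' := by
  haveI := isCharNeTwoNF_zywinaCurve m n
  haveI := isIntegral_zywinaCurve m n
  obtain ⟨hn, hq, hm2⟩ := ne_zero_aux h
  rw [P₁_add_P₂ h]
  have hy : 2 * (12 * n * ((m : ℚ) + 16 * (n : ℚ) ^ 2)) ≠ 0 := by positivity
  refine exists_some_of_eq ((zywinaCurve m n).exists_two_nsmul_eq rfl (nonsingular_P₃ h) hy) ?_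
  simp only [zywinaCurve]; push_cast
  field_simp
  ring

end Doubles

/-! ### Generic helpers: `x = α²/d²` in lowest terms, its numerator and its `ℓ`-adic size -/

section Generic

variable {ℓ : ℕ} [Fact ℓ.Prime]

/-- `num (α²/d²) = α²` for `α, d` coprime, `d > 0`. -/
theorem num_sq_div_sq {α d : ℕ} (hcop : Nat.Coprime α d) (hd : 0 < d) :
    (((α : ℚ) ^ 2 / (d : ℚ) ^ 2 : ℚ)).num = (α : ℤ) ^ 2 := by
  have h := Rat.num_div_eq_of_coprime (a := (α : ℤ) ^ 2) (b := (d : ℤ) ^ 2) (by positivity)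
    (by simpa [Int.natAbs_pow] using hcop.pow 2 2)
  push_cast at h
  exact h

/-- For a prime `ℓ ∣ d` (`α, d` coprime): `‖α²/d²‖_ℓ > 1`. -/
theorem one_lt_norm_sq_div_sq {α d : ℕ} (hcop : Nat.Coprime α d) (hd : 0 < d) (hℓd : ℓ ∣ d) :
    1 < ‖(((α : ℚ) ^ 2 / (d : ℚ) ^ 2 : ℚ) : ℚ_[ℓ])‖ := by
  have hℓ : ℓ.Prime := Fact.out
  have hα : ‖(α : ℚ_[ℓ])‖ = 1 := by
    rw [Padic.norm_natCast_eq_one_iff]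
    exact (Nat.Coprime.coprime_dvd_right hℓd hcop).symm
  have hdlt : ‖(d : ℚ_[ℓ])‖ < 1 := Padic.norm_natCast_lt_one_iff.mpr hℓd
  have hd0 : (d : ℚ_[ℓ]) ≠ 0 := by exact_mod_cast hd.ne'
  have hdpos : 0 < ‖(d : ℚ_[ℓ])‖ := norm_pos_iff.mpr hd0
  push_cast
  rw [norm_div, norm_pow, norm_pow, hα, one_pow, one_div]
  exact one_lt_inv_iff₀.mpr ⟨by positivity, by nlinarith⟩

/-- For a prime `ℓ ∤ α`: `‖α²/d²‖_ℓ⁻¹ = ‖d‖_ℓ²`. -/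
theorem inv_norm_sq_div_sq {α d : ℕ} (hα : ℓ.Coprime α) :
    ‖(((α : ℚ) ^ 2 / (d : ℚ) ^ 2 : ℚ) : ℚ_[ℓ])‖⁻¹ = ‖(d : ℚ_[ℓ])‖ ^ 2 := by
  have hα' : ‖(α : ℚ_[ℓ])‖ = 1 := Padic.norm_natCast_eq_one_iff.mpr hα
  push_cast
  rw [norm_div, norm_pow, norm_pow, hα', one_pow, inv_div, div_one]

/-- An integer which is non-zero modulo `ℓ` is an `ℓ`-adic unit. -/
theorem norm_intCast_eq_one_of_zmod_ne_zero {z : ℤ} (h : (z : ZMod ℓ) ≠ 0) :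
    ‖(z : ℚ_[ℓ])‖ = 1 := by
  refine le_antisymm (Padic.norm_int_le_one z) (not_lt.mp fun hlt => h ?_)
  rw [Padic.norm_intCast_lt_one_iff] at hlt
  exact (ZMod.intCast_zmod_eq_zero_iff_dvd z ℓ).mpr hlt

/-- A prime `c ≠ ℓ` is non-zero in `ZMod ℓ`. -/
theorem natCast_zmod_ne_zero_of_prime_ne {c : ℕ} (hc : c.Prime) (hne : ℓ ≠ c) :
    (c : ZMod ℓ) ≠ 0 := by
  rw [Ne, ZMod.natCast_eq_zero_iff]
  intro h
  exact hne (((Nat.prime_dvd_prime_iff_eq Fact.out hc).mp h))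

/-- `n ≢ 0 (mod ℓ)` when `ℓ ∤ n`. -/
theorem natCast_zmod_ne_zero_of_not_dvd {a : ℕ} (h : ¬ ℓ ∣ a) : (a : ZMod ℓ) ≠ 0 := by
  rwa [Ne, ZMod.natCast_eq_zero_iff]

/-- From `y² = x³ + A x² + B x` with `x = α²/d²`: `(y d³)² = α⁶ + A α⁴ d² + B α² d⁴`. -/
theorem sq_mul_cube_eq {F : Type*} [Field F] {x y A B α d : F} (hd : d ≠ 0)
    (h : y ^ 2 = x ^ 3 + A * x ^ 2 + B * x) (hx : x = α ^ 2 / d ^ 2) :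
    (y * d ^ 3) ^ 2 = α ^ 6 + A * α ^ 4 * d ^ 2 + B * α ^ 2 * d ^ 4 := by
  subst hx
  field_simp at h
  linear_combination h

/-- If `‖y‖² · ‖d‖⁶ = ‖N‖` with `‖d‖ = ‖N‖ = 1` then `‖y‖ = 1`. -/
theorem norm_eq_one_of_sq {y d N : ℚ_[ℓ]} (h : (y * d ^ 3) ^ 2 = N) (hd : ‖d‖ = 1) (hN : ‖N‖ = 1) :
    ‖y‖ = 1 := by
  have e := congrArg (fun t : ℚ_[ℓ] => ‖t‖) h
  simp only [norm_pow, norm_mul, hd, one_pow, mul_one, hN] at e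
  exact (pow_eq_one_iff_of_nonneg (norm_nonneg y) two_ne_zero).mp e

end Generic
end Summit.BirchSwinnertonDyer.Rank2Observatory.ZywinaFamily
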